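import Literature.NumberTheory.ComplexMultiplication.FiniteQAlgebraLatticeRadicalProjection
import Literature.NumberTheory.ComplexMultiplication.FiniteQAlgebraLatticeSquareZeroRadical
import Mathlib.RingTheory.Nilpotent.Basic
import Mathlib.Algebra.Ring.GeomSum
import Mathlib.RingTheory.AdjoinRoot
import HarnessLib

/-!
# FADDEEV'S INJECTIVITY `G([Λ]_ε) ↪ G([pr_F Λ]_ε)` (Hertling–Larabi 2026 Thm. 9.2 ∕ 2026b Thm. 5.10, the half
# «due to Faddeev [Fa68]»), def-free for a surjective ring homomorphism `π : A → B` with NIL kernel, and its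
# corollary for LOCAL `A` with residue field `ℚ` — Hertling–Larabi 2026b Lemma 10.1: `G([Λ]_ε) = {[Λ]_ε}` and
# `W(𝓛(A)) = 𝓔(A)` — for `A = ℚ[a]/(aⁿ)` (HL's (10.1)), `A = ℚ1 ⊕ M` (`M² = 0`) and every such `A`

[topic NumberTheory/ComplexMultiplication] General-`A` series (namespace
`Literature.NumberTheory.ComplexMultiplication.FiniteQAlgebraLattice`); sequel of
`FiniteQAlgebraLatticeRadicalProjection` (Lemma 9.1, Thm. 9.2 SURJECTIVITY; its docstring: «NOT here: the
injectivity of (9.7) `G([Λ]_ε) → G([Λ_0]_ε)` (Faddeev 1968, cited by HL without proof)» — supplied here),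
`FiniteQAlgebraLatticeLocallyPrincipal` (Thm. 7.3 «⇒» [Fa65]: invertible ⟹ locally principal),
`FiniteQAlgebraLatticeLocalization` (Thm. 7.2: agreement at `p`, `L = ⋂_p L_(p)`),
`FiniteQAlgebraLatticeWeakEquivalence` (Thm. 5.7: `w`-equivalence) and `FiniteQAlgebraLatticeSquareZeroRadical`
(`π(L) = gℤ` over `B = ℚ`).  Lane `lit-hodgefound` (Track 2 foundations library), seat p19 generation 37, row g37-#7.
THEOREMS ONLY: no definition, no instance, no notation, no named fact (D-0026, net Literature debt `0`), no `sorry`.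

DEF-FREE SPELLING (as in the files above).  `π(M)` is `M.map (π : A →+ B).toIntLinearMap`; HL's `pr_F : A = F ⊕ R →
F` is replaced by ANY surjective ring homomorphism `π : A →+* B` of commutative rings whose kernel consists of
nilpotent elements (`∀ x, π x = 0 → IsNilpotent x`; for `pr_F` the kernel is the radical `R`); «`L ∈ G(Λ)`» is
`IsFullLattice A L ∧ L / L = Λ ∧ L * ((L / L) / L) = L / L` (full, exact order `Λ`, invertible — Thm. 5.6 (c));
«`L_1 ∼_ε L_2`» is `∃ u : Aˣ, u • L_1 = L_2`; «`L_1 ∼_w L_2`» is `1 ∈ (L_1 / L_2) * (L_2 / L_1)` (Thm. 5.7 (a));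
«`L_1`, `L_2` agree at `p`» is `∃ s : ℤ, ¬ ↑p ∣ s ∧ sL_1 ⊆ L_2 ∧ sL_2 ⊆ L_1`; an order is `1 ∈ Λ ∧ Λ * Λ ≤ Λ`.

## Sources, VERBATIM

C. Hertling, K. Larabi, *Semigroups from full lattices in commutative ℚ-algebras*, arXiv:2602.14973 (2026)
[HertlingLarabi2026], held `paper:arxiv-2602.14973`, §9 (chunk p0024): «Part (c) gives rise to two group
homomorphisms, `G(Λ) → G(Λ_0), L ↦ pr_FL` (9.6), `G([Λ]_ε) → G([Λ_0]_ε), [L]_ε ↦ [pr_FL]_ε` (9.7). […] The more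
difficult part of Theorem 9.2 is due to Faddeev [Fa68], namely the injectivity of the map in (9.7). **Theorem 9.2.**
The group homomorphism in (9.6) is surjective. The group homomorphism in (9.7) is an isomorphism. *Proof:* […]
Together with Faddeev's result [Fa68] that the group homomorphism in (9.7) is injective, this implies that it is an
isomorphism. […] The map in (9.7) is injective by [Fa68]. □ **Remarks 9.3.** (i) Also Faddeev's proof of the
injectivity of the map in (9.7) uses the localization in section 7. It is not difficult. We have a different proof
without localization.»  [Fa68] = D. K. Faddeev, *Equivalence of systems of integer matrices*, Izv. Akad. Nauk SSSR
Ser. Mat. 30 (1966) 449–454; Amer. Math. Soc. Transl. (2) 71 (1968) 43–48 [Faddeev1968] (not held; HL print no proof —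
the localization proof below is ours along the road Rem. 9.3 (i) names).

C. Hertling, K. Larabi, *Conjugacy classes of regular integer matrices*, arXiv:2602.15748 (2026)
[HertlingLarabi2026b], held `paper:arxiv-2602.15748`, §5 (chunk p0010): «The more difficult part of Theorem 5.10,
namely the injectivity of the map in (5.16), is due to Faddeev [Fa68]. The proofs of injectivity and surjectivity
use the localization in [HL26]. **Theorem 5.10** (Fa68) [HL26]. Let `Λ` be an order in `A`. Write `Λ_0 := pr_FΛ`
for the induced order in `F`. […] `G(Λ) → G(Λ_0), L ↦ pr_FL` (5.16), `G([Λ]_ε) → G([Λ_0]_ε), [L]_ε ↦ [pr_FL]_ε`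
(5.17). The group homomorphism in (5.16) is surjective. The group homomorphism in (5.17) is an isomorphism.»
§10.1 (chunk p0033): «The corresponding algebra is `A = ℚ·1_A ⊕ ℚ·a + … + ℚ·a^{n−1}` with `a^n = 0` (10.1). It is
irreducible. Its separable part is `F = ℚ·1_A`, its nilpotent part is `R = ℚ·a + … + ℚ·a^{n−1}`. […] The fact that
the separable part of `A` is `F = ℚ·1_A` has strong implications. **Lemma 10.1.** For each order `Λ` in `A` the
group of `ε`-classes of invertible exact `Λ`-ideals is just `G([Λ]_ε) = {[Λ]_ε}`. Each `w`-class of full lattices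
contains only one `ε`-class, so `W(𝓛(A)) = 𝓔(A)`. *Proof:* `F = ℚ·1_A ⊂ A` has only one order, the order
`Λ_0 := ℤ·1_A`. It satisfies `G([Λ_0]_ε) = {[Λ_0]_ε}`. Under the projection `pr_F : A → F` with respect to the
decomposition `A = F ⊕ R`, each order `Λ` is mapped to `Λ_0`. By Theorem 5.10 the induced group homomorphism
`G([Λ]_ε) → G([Λ_0]_ε)` is an isomorphism. Therefore `G([Λ]_ε) = {[Λ]_ε}`. By Theorem 5.5 (d) each `w`-class of
full lattices contains only one `ε`-class. □»  §5 Thm. 5.5 (chunk p0009): «(a) […] equivalent. (i) `L_1 ∼_w L_2`.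
(ii) `1 ∈ (L_1:L_2)(L_2:L_1)`. (iii) `𝒪(L_1) = 𝒪(L_2)` and `L_3 ∈ G(𝒪(L_1))` with `L_1L_3 = L_2` exists. […]
(b) Let `L_1, L_2 ∈ 𝓛(A)` with `L_1 ∼_w L_2`. Then `L_1:L_2 ∈ G(𝒪(L_1))`, `L_2:L_1 ∈ G(𝒪(L_1))`, […]
`L_2 = (L_2:L_1)L_1` […] (d) Let `Λ` be an order […] `G(Λ) = [Λ]_w` and `G([Λ]_ε) = [[Λ]_ε]_w`.»

## The proof of the injectivity (localization, as Rem. 9.3 (i) says Faddeev's is)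

Let `Λ` be an order, `L ∈ G(Λ)` and `π(L) = f·π(Λ)` with `f ∈ B^{unit}`.  (0) `f = f·π(1) ∈ π(L)`, so `f = π(ℓ)`
with `ℓ ∈ L`; `ℓ` is a UNIT of `A` since `π(ℓ)` is a unit and `ker π` is nil
(`isUnit_of_isUnit_map_of_forall_isNilpotent`); `L' := ℓ⁻¹L ∈ G(Λ)` has `1 ∈ L'` and `π(L') = π(Λ)`.  It remains
(`eq_of_one_mem_of_map_le_map`): `L ∈ G(Λ)`, `1 ∈ L`, `π(L) ⊆ π(Λ)` ⟹ `L = Λ`.  (1) By Thm. 7.3 [Fa65]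
(`exists_forall_prime_locEq_units_smul_of_mul_div_div_eq`) `L_(p) = a_pΛ_(p)` with `a_p ∈ A^{unit}` for every
prime `p`: `sL ⊆ a_pΛ`, `s·a_pΛ ⊆ L`, `p ∤ s`.  (2) `c := s·a_p⁻¹ ∈ Λ` (as `1 ∈ L`) and `s·a_p ∈ L`, so
`π(s·a_p) = π(d)` with `d ∈ Λ` (as `π(L) ⊆ π(Λ)`); then `cd ∈ Λ`, `π(cd) = π(c·s·a_p) = s²`, i.e.
`cd = s²·1 + n` with `n ∈ Λ ∩ ker π` NILPOTENT, `n^N = 0`.  (3) The geometric sum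
`e := d·Σ_{i<N} (s²·1)^i (−n)^{N−1−i} ∈ Λ` has `c·e = (s²·1)^N − (−n)^N = s^{2N}·1`
(`exists_mem_mul_eq_pow_smul_one`): `c ∈ Λ_(p)^{unit}`.  (4) Hence `a_pΛ_(p) = Λ_(p)`: with `t := s^{2N}·s`,
`t·a_pΛ ⊆ Λ` (as `s^{2N}a_p = s·e`) and `t·Λ ⊆ a_pΛ` (as `a_p⁻¹·t = s^{2N}·c`).  So `L_(p) = Λ_(p)` for every `p`,
and `L = Λ` by Thm. 7.2 (a) (`eq_of_forall_prime_locEq`).  For two lattices `L_1, L_2 ∈ G(Λ)` with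
`π(L_2) = f·π(L_1)` one applies this to `L_2:L_1 = L_2L_1⁻¹ ∈ G(Λ)` (Thm. 5.7 (b), Lemma 8.1 (a)), whose image is
`f·π(L_1)·π(L_1⁻¹) = f·π(Λ)`, and uses `L_2 = (L_2:L_1)L_1`.  Over `B = ℚ` (`π : A →ₐ[ℚ] ℚ` with nil kernel, i.e.
`A` LOCAL with residue field `ℚ`) the hypothesis `π(L) ∼_ε π(Λ)` is automatic: `π(L) = gℤ`, `π(Λ) = g'ℤ` with
`g, g' ≠ 0` (`FiniteQAlgebraLatticeSquareZeroRadical.exists_map_eq_span_singleton`) — this is Lemma 10.1.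

## What is proved (`A`, `B` commutative rings, `A` a `ℚ`-algebra where lattices are localized)

* §1 `isUnit_of_isUnit_map_of_forall_isNilpotent` (units lift along a surjection with nil kernel),
  **`exists_mem_mul_eq_pow_smul_one`** (LOCAL units lift modulo nilpotents: `cd = r·1 + n`, `n ∈ Λ` nilpotent ⟹
  `ce = r^N·1` with `e ∈ Λ`).
* §2 THEOREM 9.2 ∕ 5.10, INJECTIVITY [Fa68]: **`eq_of_one_mem_of_map_le_map`** (`L ∈ G(Λ)`, `1 ∈ L`, `π(L) ⊆ π(Λ)` ⟹
  `L = Λ`), **`exists_units_smul_eq_of_map_eq_units_smul_map`** (the KERNEL of (9.7) is trivial: `π(L) = f·π(Λ)` ⟹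
  `L = uΛ`, `u ∈ L ∩ A^{unit}`), **`exists_units_smul_eq_of_map_eq_units_smul_map_of_div_self_eq`** ((9.7) is
  INJECTIVE: `L_1, L_2 ∈ G(Λ)`, `π(L_2) = f·π(L_1)` ⟹ `L_2 = uL_1`).
* §3 LEMMA 10.1 for every LOCAL `A` with residue field `ℚ` (`π : A →ₐ[ℚ] ℚ`, `ker π` nil):
  `exists_map_eq_units_smul_map_rat` (`π(L) ∼_ε π(M)` in `ℚ`), **`exists_units_smul_eq_of_forall_isNilpotent`**
  (`G([Λ]_ε) = {[Λ]_ε}`: every `L ∈ G(Λ)` is `uΛ`), `exists_units_smul_eq_of_div_self_eq_of_forall_isNilpotent`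
  (invertible lattices with the same order are `ε`-equivalent),
  **`exists_units_smul_eq_of_one_mem_div_mul_div_of_forall_isNilpotent`** (`W(𝓛(A)) = 𝓔(A)`: `L_1 ∼_w L_2 ⟹
  L_1 ∼_ε L_2`), `exists_units_smul_eq_iff_one_mem_div_mul_div_of_forall_isNilpotent` (`∼_ε ⟺ ∼_w`).
* §5 REMARKS 3.2 (iii): `isUnit_iff_isUnit_map_of_forall_isNilpotent` (`pr_F⁻¹(F^{unit}) = A^{unit}`),
  `exists_units_map_eq_of_forall_isNilpotent` (`pr_F(A^{unit}) = F^{unit}`).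
* §4 The hypothesis for HL's algebras: `isNilpotent_of_map_eq_zero_of_forall_exists_isNilpotent_sub` (every element
  `q·1 +` nilpotent ⟹ every `π : A →ₐ[ℚ] ℚ` has nil kernel); `A = ℚ[a]/(aⁿ) = AdjoinRoot (Xⁿ)` (10.1):
  `adjoinRoot_X_pow_exists_isNilpotent_sub`, **`adjoinRoot_X_pow_exists_units_smul_eq`** (Lemma 10.1 first sentence
  AS PRINTED), **`adjoinRoot_X_pow_exists_units_smul_eq_iff_one_mem_div_mul_div`** (second sentence AS PRINTED);
  `A = ℚ1 ⊕ M`, `M² = 0` (`TrivSqZeroExt ℚ M`, HL26b §12): `trivSqZeroExt_exists_isNilpotent_sub`,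
  `trivSqZeroExt_exists_units_smul_eq`, `trivSqZeroExt_exists_units_smul_eq_iff_one_mem_div_mul_div`.

## References

* [HertlingLarabi2026] C. Hertling, K. Larabi, arXiv:2602.14973 (2026), §9 Thm. 9.2, Rem. 9.3 (i) (chunk p0024);
  §7 Thm. 7.2, 7.3 (chunk p0018). [cite: HertlingLarabi2026, §9 Thm. 9.2 and Rem. 9.3 (i), chunk p0024]
* [HertlingLarabi2026b] C. Hertling, K. Larabi, arXiv:2602.15748 (2026), §5 Thm. 5.5, Thm. 5.10 (chunks p0009–p0010),
  §10 Lemma 10.1 (chunk p0033). [cite: HertlingLarabi2026b, §10 Lemma 10.1, chunk p0033]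
* [Faddeev1968] D. K. Faddeev, Equivalence of systems of integer matrices, Amer. Math. Soc. Transl. (2) 71 (1968)
  43–48, doi:10.1090/trans2/071/02 (as cited by [HertlingLarabi2026] Thm. 9.2). [cite: Faddeev1968, as cited by HertlingLarabi2026 §9 Thm. 9.2]
-/

open scoped Pointwise
open Module Function Polynomial Submodule

open Literature.NumberTheory.Automorphic (IsFullLattice mem_units_smul_submodule_iff)

namespace Literature.NumberTheory.ComplexMultiplication.FiniteQAlgebraLattice

/-! ## §1 Units and local units lift modulo a nil ideal -/

section NilKernel

variable {A B : Type} [CommRing A] [CommRing B]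

/-- **Units lift along a surjection with nil kernel**: if `π : A → B` is onto, every element of `ker π` is nilpotent,
and `π(x)` is a unit, then `x` is a unit («Of course `F^{unit} ⊂ A^{unit}`» for `pr_F`; here `xy = 1 + (xy − 1)` with
`xy − 1 ∈ ker π` nilpotent). [cite: HertlingLarabi2026, §9 proof of Thm. 9.2, chunk p0024] -/
theorem isUnit_of_isUnit_map_of_forall_isNilpotent {π : A →+* B} (hπ : Surjective π)
    (hnil : ∀ x, π x = 0 → IsNilpotent x) {x : A} (hx : IsUnit (π x)) : IsUnit x := by
  obtain ⟨y, hy⟩ := hπ ((hx.unit⁻¹ : Bˣ) : B)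
  have h1 : π (x * y - 1) = 0 := by
    rw [map_sub, map_mul, hy, map_one, IsUnit.mul_val_inv, sub_self]
  have h2 : IsUnit (1 + (x * y - 1)) := (hnil _ h1).isUnit_one_add
  have e : (1 : A) + (x * y - 1) = x * y := by ring
  rw [e] at h2
  exact isUnit_of_mul_isUnit_left h2

omit [CommRing B] in
/-- Powers of elements of an order lie in the order. [folklore] -/
private theorem pow_mem_of_one_mem_of_mul_le {Λ : Submodule ℤ A} (h1 : (1 : A) ∈ Λ) (hΛΛ : Λ * Λ ≤ Λ)
    {x : A} (hx : x ∈ Λ) : ∀ n : ℕ, x ^ n ∈ Λ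
  | 0 => by rw [pow_zero]; exact h1
  | n + 1 => by
    rw [pow_succ]
    exact hΛΛ (mul_mem_mul (pow_mem_of_one_mem_of_mul_le h1 hΛΛ hx n) hx)

/-- `p ∤ s`, `p ∤ s'` ⟹ `p ∤ ss'` for a prime `p`. [folklore] -/
private theorem not_dvd_mul_of_prime {p : ℕ} (hp : p.Prime) {s s' : ℤ} (hs : ¬ (p : ℤ) ∣ s)
    (hs' : ¬ (p : ℤ) ∣ s') : ¬ (p : ℤ) ∣ s * s' :=
  fun h => ((Nat.prime_iff_prime_int.1 hp).dvd_or_dvd h).elim hs hs'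

/-- `p ∤ s` ⟹ `p ∤ s^k` for a prime `p`. [folklore] -/
private theorem not_dvd_pow_of_prime {p : ℕ} (hp : p.Prime) {s : ℤ} (hs : ¬ (p : ℤ) ∣ s) (k : ℕ) :
    ¬ (p : ℤ) ∣ s ^ k :=
  fun h => hs ((Nat.prime_iff_prime_int.1 hp).dvd_of_dvd_pow h)

omit [CommRing B] in
/-- **LOCAL UNITS LIFT MODULO NILPOTENTS** — in an order `Λ` (`1 ∈ Λ`, `ΛΛ ⊆ Λ`): if `cd = r·1 + n` with `d, n ∈ Λ`
and `n` nilpotent (`n^N = 0`), then `ce = r^N·1` for the element `e := d·Σ_{i<N} (r·1)^i(−n)^{N−1−i} ∈ Λ` (the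
geometric sum: `(Σ_{i<N} x^i y^{N−1−i})(x − y) = x^N − y^N` with `x = r·1`, `y = −n`).  With `p ∤ r` this says: `c`
is a unit of the local ring `Λ_(p)` as soon as it is one modulo the nilpotent elements («`a_p ∈ Λ_(p)^{unit}`»,
Thm. 8.2 (b)). [cite: HertlingLarabi2026, §9 Rem. 9.3 (i) («uses the localization in section 7»), chunk p0024] -/
theorem exists_mem_mul_eq_pow_smul_one {Λ : Submodule ℤ A} (h1 : (1 : A) ∈ Λ) (hΛΛ : Λ * Λ ≤ Λ)
    {c d n : A} (hd : d ∈ Λ) (hn : n ∈ Λ) (hnil : IsNilpotent n) {r : ℤ}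
    (hcd : c * d = r • (1 : A) + n) : ∃ e ∈ Λ, ∃ N : ℕ, c * e = (r ^ N) • (1 : A) := by
  obtain ⟨N, hN⟩ := hnil
  refine ⟨d * ∑ i ∈ Finset.range N, (r • (1 : A)) ^ i * (-n) ^ (N - 1 - i), ?_, N, ?_⟩
  · exact hΛΛ (mul_mem_mul hd (sum_mem fun i _ => hΛΛ (mul_mem_mul
      (pow_mem_of_one_mem_of_mul_le h1 hΛΛ (Λ.smul_mem r h1) i)
      (pow_mem_of_one_mem_of_mul_le h1 hΛΛ (Λ.neg_mem hn) (N - 1 - i)))))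
  · have h := geom_sum₂_mul (r • (1 : A)) (-n) N
    rw [sub_neg_eq_add, neg_pow n N, hN, mul_zero, sub_zero, _root_.smul_pow, one_pow] at h
    rw [← mul_assoc, hcd]
    exact (mul_comm _ _).trans h

end NilKernel

/-! ## §2 Theorem 9.2 ∕ 5.10 [Fa68]: `G([Λ]_ε) → G([πΛ]_ε)`, `[L]_ε ↦ [πL]_ε`, is injective -/

section Injective

variable {A B : Type} [CommRing A] [CommRing B] [Algebra ℚ A]

/-- **THEOREM 9.2 ∕ 5.10, the core of the INJECTIVITY [Fa68]: for an order `Λ`, a ring homomorphism `π : A → B` whose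
kernel consists of nilpotent elements, and `L ∈ G(Λ)` (full, `𝒪(L) = Λ`, invertible) with `1 ∈ L` and
`π(L) ⊆ π(Λ)`: `L = Λ`** — by Thm. 7.3 `L_(p) = a_pΛ_(p)`; `c := s·a_p⁻¹ ∈ Λ` satisfies `cd = s²·1 + n` with
`d ∈ Λ`, `n ∈ Λ ∩ ker π` nilpotent, so `c ∈ Λ_(p)^{unit}` (§1) and `a_pΛ_(p) = Λ_(p)`; hence `L_(p) = Λ_(p)` for all
`p` and `L = Λ` (Thm. 7.2 (a)). [cite: HertlingLarabi2026, §9 Thm. 9.2 («The map in (9.7) is injective by [Fa68]») and Rem. 9.3 (i), chunk p0024]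
[cite: HertlingLarabi2026b, §5 Thm. 5.10, chunk p0010] [cite: Faddeev1968, as cited by HertlingLarabi2026 §9 Thm. 9.2] -/
theorem eq_of_one_mem_of_map_le_map {π : A →+* B} (hnil : ∀ x, π x = 0 → IsNilpotent x)
    {Λ : Submodule ℤ A} (h1 : (1 : A) ∈ Λ) (hΛΛ : Λ * Λ ≤ Λ)
    {L : Submodule ℤ A} (hL : IsFullLattice A L) (hO : L / L = Λ) (hinv : L * ((L / L) / L) = L / L)
    (h1L : (1 : A) ∈ L)
    (hle : L.map (π : A →+ B).toIntLinearMap ≤ Λ.map (π : A →+ B).toIntLinearMap) : L = Λ := by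
  -- (1) Thm. 7.3: `L_(p) = a_pΛ_(p)`
  obtain ⟨a, _P₀, -, hloc⟩ := exists_forall_prime_locEq_units_smul_of_mul_div_div_eq hL hinv
  rw [hO] at hloc
  refine eq_of_forall_prime_locEq fun p hp => locEq_trans hp (hloc p hp) ?_
  obtain ⟨s, hs, h₁, h₂⟩ := hloc p hp
  -- (2) `c := s·a_p⁻¹ ∈ Λ`, `d ∈ Λ` with `π(d) = π(s·a_p)`, `n := cd − s²·1 ∈ Λ ∩ ker π`
  obtain ⟨c, hc⟩ : ∃ c : A, c = s • (((a p)⁻¹ : Aˣ) : A) := ⟨_, rfl⟩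
  have hcΛ : c ∈ Λ := by
    have h := h₁ 1 h1L
    rw [mem_units_smul_submodule_iff, Units.smul_def, smul_eq_mul, mul_smul_comm, mul_one] at h
    rwa [hc]
  have haL : s • ((a p : Aˣ) : A) ∈ L := h₂ _ (by
    rw [mem_units_smul_submodule_iff, Units.smul_def, smul_eq_mul, Units.inv_mul]
    exact h1)
  obtain ⟨d, hd, hdeq⟩ := mem_map.1 (hle (mem_map_of_mem haL))
  change π d = π (s • ((a p : Aˣ) : A)) at hdeq
  have hcsa : c * (s • ((a p : Aˣ) : A)) = (s * s) • (1 : A) := by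
    rw [hc]
    simp only [zsmul_eq_mul, Int.cast_mul]
    rw [mul_mul_mul_comm, Units.inv_mul]
  obtain ⟨n, hn⟩ : ∃ n : A, n = c * d - (s * s) • (1 : A) := ⟨_, rfl⟩
  have hnΛ : n ∈ Λ := hn ▸ Λ.sub_mem (hΛΛ (mul_mem_mul hcΛ hd)) (Λ.smul_mem _ h1)
  have hπn : π n = 0 := by
    rw [hn, map_sub, map_mul, hdeq, ← map_mul, hcsa, sub_self]
  have hcd : c * d = (s * s) • (1 : A) + n := by rw [hn]; abel
  -- (3) `c·e = s^{2N}·1` with `e ∈ Λ`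
  obtain ⟨e, he, N, hce⟩ := exists_mem_mul_eq_pow_smul_one h1 hΛΛ hd hnΛ (hnil n hπn) hcd
  -- (4) `a_pΛ` and `Λ` agree at `p`, with `t = s^{2N}·s`
  refine ⟨(s * s) ^ N * s, not_dvd_mul_of_prime hp (not_dvd_pow_of_prime hp (not_dvd_mul_of_prime hp hs hs) N) hs,
    fun x hx => ?_, fun x hx => ?_⟩
  · rw [mem_units_smul_submodule_iff, Units.smul_def, smul_eq_mul] at hx
    have key : ((s * s) ^ N * s) • x = s • (s • (e * ((((a p)⁻¹ : Aˣ) : A) * x))) := by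
      have hx1 : ((s * s) ^ N) • x = c * e * x := by rw [hce, smul_mul_assoc, one_mul]
      rw [hc] at hx1
      simp only [zsmul_eq_mul, Int.cast_mul, Int.cast_pow] at hx1 ⊢
      linear_combination (s : A) * hx1
    rw [key]
    exact Λ.smul_mem _ (Λ.smul_mem _ (hΛΛ (mul_mem_mul he hx)))
  · rw [mem_units_smul_submodule_iff, Units.smul_def, smul_eq_mul]
    have key : (((a p)⁻¹ : Aˣ) : A) * (((s * s) ^ N * s) • x) = ((s * s) ^ N) • (c * x) := by
      rw [hc]
      simp only [zsmul_eq_mul, Int.cast_mul, Int.cast_pow]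
      ring
    rw [key]
    exact Λ.smul_mem _ (hΛΛ (mul_mem_mul hcΛ hx))

/-- **THEOREM 9.2 ∕ 5.10, INJECTIVITY [Fa68] — the kernel of (9.7) `G([Λ]_ε) → G([πΛ]_ε)` is trivial: for an order
`Λ`, a surjective ring homomorphism `π : A → B` whose kernel consists of nilpotent elements (for `pr_F : F ⊕ R → F`:
the radical `R`), and `L ∈ G(Λ)` with `π(L) = f·π(Λ)`, `f ∈ B^{unit}`, there is a unit `u ∈ L` of `A` with
`L = uΛ`** (`f = π(ℓ)` with `ℓ ∈ L` a unit of `A`; `ℓ⁻¹L = Λ` by `eq_of_one_mem_of_map_le_map`).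
[cite: HertlingLarabi2026, §9 Thm. 9.2 («The group homomorphism in (9.7) is an isomorphism»), chunk p0024]
[cite: HertlingLarabi2026b, §5 Thm. 5.10 («The group homomorphism in (5.17) is an isomorphism»), chunk p0010]
[cite: Faddeev1968, as cited by HertlingLarabi2026 §9 Thm. 9.2] -/
theorem exists_units_smul_eq_of_map_eq_units_smul_map {π : A →+* B} (hπ : Surjective π)
    (hnil : ∀ x, π x = 0 → IsNilpotent x)
    {Λ : Submodule ℤ A} (h1 : (1 : A) ∈ Λ) (hΛΛ : Λ * Λ ≤ Λ)
    {L : Submodule ℤ A} (hL : IsFullLattice A L) (hO : L / L = Λ) (hinv : L * ((L / L) / L) = L / L)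
    {f : Bˣ} (hf : L.map (π : A →+ B).toIntLinearMap = f • Λ.map (π : A →+ B).toIntLinearMap) :
    ∃ u : Aˣ, (u : A) ∈ L ∧ u • Λ = L := by
  -- `f = π(ℓ)` with `ℓ ∈ L`, a unit of `A`
  have hfL : (f : B) ∈ L.map (π : A →+ B).toIntLinearMap := by
    rw [hf, mem_units_smul_submodule_iff, Units.smul_def, smul_eq_mul, Units.inv_mul]
    exact one_mem_map π h1
  obtain ⟨ℓ, hℓL, hℓ⟩ := mem_map.1 hfL
  change π ℓ = f at hℓ
  have hℓu : IsUnit ℓ :=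
    isUnit_of_isUnit_map_of_forall_isNilpotent hπ hnil (by rw [hℓ]; exact Units.isUnit f)
  obtain ⟨v, rfl⟩ := hℓu
  have hfv : Units.map (π : A →* B) v = f := Units.ext hℓ
  refine ⟨v, hℓL, ?_⟩
  -- `v⁻¹L ∈ G(Λ)`, `1 ∈ v⁻¹L`, `π(v⁻¹L) = π(Λ)`, so `v⁻¹L = Λ`
  have h := eq_of_one_mem_of_map_le_map (π := π) (L := v⁻¹ • L) hnil h1 hΛΛ (IsFullLattice.units_smul _ hL)
    (by rw [div_self_units_smul, hO]) (units_smul_mul_div_div_eq _ hinv)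
    (by rw [mem_units_smul_submodule_iff, inv_inv, Units.smul_def, smul_eq_mul, mul_one]; exact hℓL)
    (le_of_eq (by rw [map_units_smul, map_inv, hfv, hf, inv_smul_smul]))
  rw [← h, smul_inv_smul]

/-- **THEOREM 9.2 ∕ 5.10, INJECTIVITY of (9.7) [Fa68], two-lattice form: for a surjective ring homomorphism
`π : A → B` whose kernel consists of nilpotent elements and invertible full lattices `L_1, L_2` with the same order
(`L_1, L_2 ∈ G(Λ)`): `π(L_2) = f·π(L_1)` with `f ∈ B^{unit}` ⟹ `L_2 = uL_1` with `u ∈ A^{unit}`** (`L_1 ∼_w L_2`,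
so `L_2:L_1 = L_2L_1⁻¹ ∈ G(Λ)` — Thm. 5.7 (b), Lemma 8.1 (a) — has image `f·π(L_1)π(L_1⁻¹) = f·π(Λ)`, hence is `uΛ`,
and `L_2 = (L_2:L_1)L_1 = uL_1`). [cite: HertlingLarabi2026, §9 Thm. 9.2, chunk p0024]
[cite: HertlingLarabi2026b, §5 Thm. 5.10 and Thm. 5.5 (b), chunks p0009–p0010] [cite: Faddeev1968, as cited by HertlingLarabi2026 §9 Thm. 9.2] -/
theorem exists_units_smul_eq_of_map_eq_units_smul_map_of_div_self_eq {π : A →+* B} (hπ : Surjective π)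
    (hnil : ∀ x, π x = 0 → IsNilpotent x)
    {L₁ L₂ : Submodule ℤ A} (hL₁ : IsFullLattice A L₁) (hL₂ : IsFullLattice A L₂)
    (hinv₁ : L₁ * ((L₁ / L₁) / L₁) = L₁ / L₁) (hinv₂ : L₂ * ((L₂ / L₂) / L₂) = L₂ / L₂)
    (hO : L₁ / L₁ = L₂ / L₂)
    {f : Bˣ} (hf : L₂.map (π : A →+ B).toIntLinearMap = f • L₁.map (π : A →+ B).toIntLinearMap) :
    ∃ u : Aˣ, u • L₁ = L₂ := by
  -- `L₁ ∼_w L₂`: `L₃ := L₂:L₁ ∈ G(𝒪(L₁))`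
  have hw : (1 : A) ∈ (L₁ / L₂) * (L₂ / L₁) :=
    (one_mem_div_mul_div_iff_div_self_eq_of_invertible hinv₁ hinv₂).2 hO
  have hw' : (1 : A) ∈ (L₂ / L₁) * (L₁ / L₂) := by rwa [mul_comm]
  have hL₃ : IsFullLattice A (L₂ / L₁) := isFullLattice_div hL₂ hL₁
  have hinv₃ := div_mul_inv_eq_of_one_mem hw'
  have hO₃ : (L₂ / L₁) / (L₂ / L₁) = L₁ / L₁ := by
    rw [div_self_div_eq_div_self_of_one_mem hw', hO]
  -- `π(L₂:L₁) = π(L₂L₁⁻¹) = f·π(L₁L₁⁻¹) = f·π(𝒪(L₁))`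
  have h13 : L₂ / L₁ = L₂ * ((L₁ / L₁) / L₁) := div_eq_mul_inv_of_div_self_le hO.le hinv₁
  have hf₃ : (L₂ / L₁).map (π : A →+ B).toIntLinearMap = f • (L₁ / L₁).map (π : A →+ B).toIntLinearMap := by
    rw [h13, map_mul_eq_map_mul_map, hf, ← units_smul_mul, ← map_mul_eq_map_mul_map, hinv₁]
  obtain ⟨u, -, hu⟩ := exists_units_smul_eq_of_map_eq_units_smul_map hπ hnil (one_mem_div_self L₁)
    (div_self_mul_div_self L₁).le hL₃ hO₃ hinv₃ hf₃
  refine ⟨u, ?_⟩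
  rw [← div_mul_eq_of_one_mem hw, ← hu, ← units_smul_mul, div_self_mul_eq_self]

end Injective

/-! ## §3 Lemma 10.1: local `A` with residue field `ℚ` — `G([Λ]_ε) = {[Λ]_ε}` and `W(𝓛(A)) = 𝓔(A)` -/

section ResidueFieldRat

variable {A : Type} [CommRing A] [Algebra ℚ A]

/-- A `ℚ`-algebra homomorphism to `ℚ` is onto. [folklore] -/
private theorem surjective_algHom_rat (π : A →ₐ[ℚ] ℚ) : Surjective π := fun q =>
  ⟨algebraMap ℚ A q, π.commutes q⟩

/-- The two spellings of `π` as a `ℤ`-linear map agree. [folklore] -/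
private theorem toIntLinearMap_eq_restrictScalars (π : A →ₐ[ℚ] ℚ) :
    ((π : A →+* ℚ) : A →+ ℚ).toIntLinearMap = π.toLinearMap.restrictScalars ℤ :=
  LinearMap.ext fun _ => rfl

/-- Over `B = ℚ` the images of any two full lattices are `ε`-equivalent: `π(L) = f·π(M)` with `f ∈ ℚ^{unit}` (`π(L) =
gℤ`, `π(M) = g'ℤ` with `g, g' ≠ 0`: «`F = ℚ·1_A ⊂ A` has only one order, the order `Λ_0 := ℤ·1_A`. It satisfies
`G([Λ_0]_ε) = {[Λ_0]_ε}`»). [cite: HertlingLarabi2026b, §10 Lemma 10.1 (proof), chunk p0033] -/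
theorem exists_map_eq_units_smul_map_rat (π : A →ₐ[ℚ] ℚ) {L M : Submodule ℤ A} (hL : IsFullLattice A L)
    (hM : IsFullLattice A M) :
    ∃ f : ℚˣ, L.map ((π : A →+* ℚ) : A →+ ℚ).toIntLinearMap =
      f • M.map ((π : A →+* ℚ) : A →+ ℚ).toIntLinearMap := by
  rw [toIntLinearMap_eq_restrictScalars]
  obtain ⟨g, hg⟩ := exists_map_eq_span_singleton π hL.1
  obtain ⟨g', hg'⟩ := exists_map_eq_span_singleton π hM.1
  have hne : ∀ {N : Submodule ℤ A} {k : ℚ}, IsFullLattice A N →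
      N.map (π.toLinearMap.restrictScalars ℤ) = span ℤ {k} → k ≠ 0 := by
    intro N k hN hk h0
    obtain ⟨x, hx, hx0⟩ := exists_mem_map_ne_zero π hN
    have hxk : π x ∈ span ℤ {k} := hk ▸ mem_map_of_mem hx
    rw [h0, mem_span_singleton] at hxk
    obtain ⟨m, hm⟩ := hxk
    exact hx0 (by rw [← hm, smul_zero])
  have hg0 : g ≠ 0 := hne hL hg
  have hg'0 : g' ≠ 0 := hne hM hg'
  refine ⟨Units.mk0 g hg0 * (Units.mk0 g' hg'0)⁻¹, ?_⟩
  rw [hg, hg', Units.smul_def, smul_span, Set.smul_set_singleton, smul_eq_mul, Units.val_mul,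
    Units.val_inv_eq_inv_val, Units.val_mk0, Units.val_mk0, inv_mul_cancel_right₀ hg'0]

/-- **LEMMA 10.1, first sentence, for every LOCAL `A` with residue field `ℚ`: `G([Λ]_ε) = {[Λ]_ε}`** — if
`π : A → ℚ` is a `ℚ`-algebra homomorphism whose kernel consists of nilpotent elements (`A = ℚ·1_A ⊕ R` with `R`
nil: `A = ℚ[a]/(aⁿ)` of (10.1), `ℚ[x,y]/(x²,xy,y²)`, `ℚ[x,y]/(x²,y²)`, …), then for every order `Λ` and every
`L ∈ G(Λ)` (full, `𝒪(L) = Λ`, invertible) there is a unit `u ∈ L` with `L = uΛ` («the group of `ε`-classes of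
invertible exact `Λ`-ideals is just `G([Λ]_ε) = {[Λ]_ε}`»; HL: `G([Λ]_ε) ≅ G([ℤ·1]_ε) = 1` by Thm. 5.10).
[cite: HertlingLarabi2026b, §10 Lemma 10.1, chunk p0033] [cite: HertlingLarabi2026b, §5 Thm. 5.10, chunk p0010] -/
theorem exists_units_smul_eq_of_forall_isNilpotent (π : A →ₐ[ℚ] ℚ) (hnil : ∀ x, π x = 0 → IsNilpotent x)
    {Λ : Submodule ℤ A} (hΛ : IsFullLattice A Λ) (h1 : (1 : A) ∈ Λ) (hΛΛ : Λ * Λ ≤ Λ)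
    {L : Submodule ℤ A} (hL : IsFullLattice A L) (hO : L / L = Λ) (hinv : L * ((L / L) / L) = L / L) :
    ∃ u : Aˣ, (u : A) ∈ L ∧ u • Λ = L := by
  obtain ⟨f, hf⟩ := exists_map_eq_units_smul_map_rat π hL hΛ
  exact exists_units_smul_eq_of_map_eq_units_smul_map (surjective_algHom_rat π) (fun x hx => hnil x hx)
    h1 hΛΛ hL hO hinv hf

/-- **LEMMA 10.1 for LOCAL `A` with residue field `ℚ`, two-lattice form: invertible full lattices with the same
order are `ε`-equivalent** (`G([Λ]_ε) = {[Λ]_ε}`). [cite: HertlingLarabi2026b, §10 Lemma 10.1, chunk p0033] -/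
theorem exists_units_smul_eq_of_div_self_eq_of_forall_isNilpotent (π : A →ₐ[ℚ] ℚ)
    (hnil : ∀ x, π x = 0 → IsNilpotent x)
    {L₁ L₂ : Submodule ℤ A} (hL₁ : IsFullLattice A L₁) (hL₂ : IsFullLattice A L₂)
    (hinv₁ : L₁ * ((L₁ / L₁) / L₁) = L₁ / L₁) (hinv₂ : L₂ * ((L₂ / L₂) / L₂) = L₂ / L₂)
    (hO : L₁ / L₁ = L₂ / L₂) : ∃ u : Aˣ, u • L₁ = L₂ := by
  obtain ⟨f, hf⟩ := exists_map_eq_units_smul_map_rat π hL₂ hL₁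
  exact exists_units_smul_eq_of_map_eq_units_smul_map_of_div_self_eq (surjective_algHom_rat π)
    (fun x hx => hnil x hx) hL₁ hL₂ hinv₁ hinv₂ hO hf

/-- **LEMMA 10.1, second sentence, for every LOCAL `A` with residue field `ℚ`: `W(𝓛(A)) = 𝓔(A)` — weakly
equivalent full lattices are `ε`-equivalent: `1 ∈ (L_1:L_2)(L_2:L_1) ⟹ L_2 = uL_1`, `u ∈ A^{unit}`** («Each
`w`-class of full lattices contains only one `ε`-class»: `L_2:L_1 ∈ G(𝒪(L_1))` is `u𝒪(L_1)` and
`L_2 = (L_2:L_1)L_1`, Thm. 5.5 (b), (d)). [cite: HertlingLarabi2026b, §10 Lemma 10.1 with §5 Thm. 5.5 (b), (d), chunks p0033, p0009] -/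
theorem exists_units_smul_eq_of_one_mem_div_mul_div_of_forall_isNilpotent (π : A →ₐ[ℚ] ℚ)
    (hnil : ∀ x, π x = 0 → IsNilpotent x)
    {L₁ L₂ : Submodule ℤ A} (hL₁ : IsFullLattice A L₁) (hL₂ : IsFullLattice A L₂)
    (h : (1 : A) ∈ (L₁ / L₂) * (L₂ / L₁)) : ∃ u : Aˣ, u • L₁ = L₂ := by
  have h' : (1 : A) ∈ (L₂ / L₁) * (L₁ / L₂) := by rwa [mul_comm]
  have hL₃ : IsFullLattice A (L₂ / L₁) := isFullLattice_div hL₂ hL₁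
  have hinv₃ := div_mul_inv_eq_of_one_mem h'
  have hO₃ : (L₂ / L₁) / (L₂ / L₁) = L₁ / L₁ := by
    rw [div_self_div_eq_div_self_of_one_mem h', div_self_eq_div_self_of_one_mem h]
  obtain ⟨u, -, hu⟩ := exists_units_smul_eq_of_forall_isNilpotent π hnil (isFullLattice_div hL₁ hL₁)
    (one_mem_div_self L₁) (div_self_mul_div_self L₁).le hL₃ hO₃ hinv₃
  refine ⟨u, ?_⟩
  rw [← div_mul_eq_of_one_mem h, ← hu, ← units_smul_mul, div_self_mul_eq_self]

/-- **LEMMA 10.1 for LOCAL `A` with residue field `ℚ`: `ε`-equivalence IS `w`-equivalence on full lattices,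
`W(𝓛(A)) = 𝓔(A)`.** [cite: HertlingLarabi2026b, §10 Lemma 10.1, chunk p0033] [cite: HertlingLarabi2026, §5 Thm. 5.7 (c) («⟹»), chunk p0013] -/
theorem exists_units_smul_eq_iff_one_mem_div_mul_div_of_forall_isNilpotent (π : A →ₐ[ℚ] ℚ)
    (hnil : ∀ x, π x = 0 → IsNilpotent x)
    {L₁ L₂ : Submodule ℤ A} (hL₁ : IsFullLattice A L₁) (hL₂ : IsFullLattice A L₂) :
    (∃ u : Aˣ, u • L₁ = L₂) ↔ (1 : A) ∈ (L₁ / L₂) * (L₂ / L₁) :=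
  ⟨fun ⟨_, hu⟩ => one_mem_div_mul_div_of_units_smul_eq hu,
    exists_units_smul_eq_of_one_mem_div_mul_div_of_forall_isNilpotent π hnil hL₁ hL₂⟩

/-! ## §4 The hypothesis for HL's algebras: `A = ℚ[a]/(aⁿ)` (10.1) and `A = ℚ1 ⊕ M`, `M² = 0` -/

/-- If every element of `A` is a rational scalar plus a nilpotent element (`A = ℚ·1_A ⊕ R`, `R` nil — `A` is LOCAL
with residue field `ℚ`), then the kernel of every `ℚ`-algebra homomorphism `π : A → ℚ` consists of nilpotent
elements. [cite: HertlingLarabi2026b, §10 («Its separable part is `F = ℚ·1_A`, its nilpotent part is `R`»), chunk p0033] -/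
theorem isNilpotent_of_map_eq_zero_of_forall_exists_isNilpotent_sub
    (h : ∀ x : A, ∃ q : ℚ, IsNilpotent (x - algebraMap ℚ A q)) (π : A →ₐ[ℚ] ℚ) {x : A} (hx : π x = 0) :
    IsNilpotent x := by
  obtain ⟨q, hq⟩ := h x
  have h0 : q = 0 := by
    have h' := (hq.map π).eq_zero
    rwa [map_sub, hx, AlgHom.commutes, Algebra.algebraMap_self_apply, zero_sub, neg_eq_zero] at h'
  rwa [h0, map_zero, sub_zero] at hq

end ResidueFieldRat

section Truncated

/-- In HL's algebra (10.1) `A = ℚ[a]/(aⁿ) = ℚ·1 ⊕ ℚa ⊕ … ⊕ ℚa^{n−1}`, `aⁿ = 0`, every element is a rational scalar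
plus a nilpotent element (`g(a) − g(0) ∈ aA`). [cite: HertlingLarabi2026b, §10 (10.1), chunk p0033] -/
theorem adjoinRoot_X_pow_exists_isNilpotent_sub (n : ℕ) (x : AdjoinRoot ((X : ℚ[X]) ^ n)) :
    ∃ q : ℚ, IsNilpotent (x - algebraMap ℚ (AdjoinRoot ((X : ℚ[X]) ^ n)) q) := by
  obtain ⟨g, rfl⟩ := AdjoinRoot.mk_surjective x
  refine ⟨g.coeff 0, n, ?_⟩
  have e : AdjoinRoot.mk ((X : ℚ[X]) ^ n) (g - C (g.coeff 0)) =
      AdjoinRoot.mk ((X : ℚ[X]) ^ n) g - algebraMap ℚ _ (g.coeff 0) := by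
    rw [map_sub, AdjoinRoot.algebraMap_eq]; rfl
  obtain ⟨h, hh⟩ := (X_dvd_sub_C : (X : ℚ[X]) ∣ g - C (g.coeff 0))
  rw [← e, hh, map_mul, mul_pow, ← map_pow, AdjoinRoot.mk_self, zero_mul]

/-- In `A = ℚ[a]/(aⁿ)` the kernel of every `ℚ`-algebra homomorphism `A → ℚ` (e.g. `a ↦ 0`, the projection `pr_F`)
consists of nilpotent elements. [cite: HertlingLarabi2026b, §10 (10.1), chunk p0033] -/
theorem adjoinRoot_X_pow_isNilpotent_of_map_eq_zero {n : ℕ} (π : AdjoinRoot ((X : ℚ[X]) ^ n) →ₐ[ℚ] ℚ)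
    {x : AdjoinRoot ((X : ℚ[X]) ^ n)} (hx : π x = 0) : IsNilpotent x :=
  isNilpotent_of_map_eq_zero_of_forall_exists_isNilpotent_sub (adjoinRoot_X_pow_exists_isNilpotent_sub n) π hx

/-- **LEMMA 10.1, first sentence, AS PRINTED — `A = ℚ·1_A ⊕ ℚa ⊕ … ⊕ ℚa^{n−1}`, `aⁿ = 0`, `n ≥ 1`: for each order
`Λ` in `A`, `G([Λ]_ε) = {[Λ]_ε}`** — every invertible full lattice `L` with `𝒪(L) = Λ` is `uΛ` with a unit `u ∈ L`.
[cite: HertlingLarabi2026b, §10 Lemma 10.1, chunk p0033] -/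
theorem adjoinRoot_X_pow_exists_units_smul_eq {n : ℕ} (hn : n ≠ 0)
    {Λ : Submodule ℤ (AdjoinRoot ((X : ℚ[X]) ^ n))} (hΛ : IsFullLattice (AdjoinRoot ((X : ℚ[X]) ^ n)) Λ)
    (h1 : (1 : AdjoinRoot ((X : ℚ[X]) ^ n)) ∈ Λ) (hΛΛ : Λ * Λ ≤ Λ)
    {L : Submodule ℤ (AdjoinRoot ((X : ℚ[X]) ^ n))} (hL : IsFullLattice (AdjoinRoot ((X : ℚ[X]) ^ n)) L)
    (hO : L / L = Λ) (hinv : L * ((L / L) / L) = L / L) :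
    ∃ u : (AdjoinRoot ((X : ℚ[X]) ^ n))ˣ, (u : AdjoinRoot ((X : ℚ[X]) ^ n)) ∈ L ∧ u • Λ = L :=
  exists_units_smul_eq_of_forall_isNilpotent
    (AdjoinRoot.liftAlgHom ((X : ℚ[X]) ^ n) (Algebra.ofId ℚ ℚ) 0 (by simp [hn]))
    (fun _ hx => adjoinRoot_X_pow_isNilpotent_of_map_eq_zero _ hx) hΛ h1 hΛΛ hL hO hinv

/-- **LEMMA 10.1, second sentence, AS PRINTED — `A = ℚ[a]/(aⁿ)`, `n ≥ 1`: «Each `w`-class of full lattices contains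
only one `ε`-class, so `W(𝓛(A)) = 𝓔(A)`»** — for full lattices `L_1, L_2`: `L_2 = uL_1` for a unit `u` iff
`1 ∈ (L_1:L_2)(L_2:L_1)`. [cite: HertlingLarabi2026b, §10 Lemma 10.1, chunk p0033] -/
theorem adjoinRoot_X_pow_exists_units_smul_eq_iff_one_mem_div_mul_div {n : ℕ} (hn : n ≠ 0)
    {L₁ L₂ : Submodule ℤ (AdjoinRoot ((X : ℚ[X]) ^ n))} (hL₁ : IsFullLattice (AdjoinRoot ((X : ℚ[X]) ^ n)) L₁)
    (hL₂ : IsFullLattice (AdjoinRoot ((X : ℚ[X]) ^ n)) L₂) :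
    (∃ u : (AdjoinRoot ((X : ℚ[X]) ^ n))ˣ, u • L₁ = L₂) ↔
      (1 : AdjoinRoot ((X : ℚ[X]) ^ n)) ∈ (L₁ / L₂) * (L₂ / L₁) :=
  exists_units_smul_eq_iff_one_mem_div_mul_div_of_forall_isNilpotent
    (AdjoinRoot.liftAlgHom ((X : ℚ[X]) ^ n) (Algebra.ofId ℚ ℚ) 0 (by simp [hn]))
    (fun _ hx => adjoinRoot_X_pow_isNilpotent_of_map_eq_zero _ hx) hL₁ hL₂

end Truncated

section TrivSqZeroExt

variable {M : Type} [AddCommGroup M] [Module ℚ M] [Module ℚᵐᵒᵖ M] [IsCentralScalar ℚ M]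

/-- In `A = ℚ1 ⊕ M` with `M·M = 0` (`ℚ[x,y]/(x²,xy,y²)` for `M = ℚ²`, §12) every element is a rational scalar plus a
nilpotent (square-zero) element. [cite: HertlingLarabi2026b, §12 Lemma 12.1 («`a² = ab = b² = 0`»), chunk p0041] -/
theorem trivSqZeroExt_exists_isNilpotent_sub (x : TrivSqZeroExt ℚ M) :
    ∃ q : ℚ, IsNilpotent (x - algebraMap ℚ (TrivSqZeroExt ℚ M) q) := by
  refine ⟨x.fst, 2, ?_⟩
  have e : x - algebraMap ℚ (TrivSqZeroExt ℚ M) x.fst = TrivSqZeroExt.inr x.snd := by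
    rw [TrivSqZeroExt.algebraMap_eq_inl' ℚ ℚ M x.fst, Algebra.algebraMap_self_apply]
    exact TrivSqZeroExt.ext (by simp) (by simp)
  rw [e, pow_two, TrivSqZeroExt.inr_mul_inr]

/-- **LEMMA 10.1-type statement for `A = ℚ1 ⊕ M`, `M·M = 0`: `G([Λ]_ε) = {[Λ]_ε}`** — every invertible full lattice
`L` with `𝒪(L) = Λ` is `uΛ` with a unit `u ∈ L` (for this `A` every full lattice is invertible, §12 Lemma 12.1,
`FiniteQAlgebraLatticeSquareZeroRadical.mul_div_div_eq_trivSqZeroExt`). [cite: HertlingLarabi2026b, §10 Lemma 10.1 (proof: `F = ℚ·1_A`) and §12 Lemma 12.1, chunks p0033, p0041] -/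
theorem trivSqZeroExt_exists_units_smul_eq
    {Λ : Submodule ℤ (TrivSqZeroExt ℚ M)} (hΛ : IsFullLattice (TrivSqZeroExt ℚ M) Λ)
    (h1 : (1 : TrivSqZeroExt ℚ M) ∈ Λ) (hΛΛ : Λ * Λ ≤ Λ)
    {L : Submodule ℤ (TrivSqZeroExt ℚ M)} (hL : IsFullLattice (TrivSqZeroExt ℚ M) L)
    (hO : L / L = Λ) (hinv : L * ((L / L) / L) = L / L) :
    ∃ u : (TrivSqZeroExt ℚ M)ˣ, (u : TrivSqZeroExt ℚ M) ∈ L ∧ u • Λ = L :=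
  exists_units_smul_eq_of_forall_isNilpotent (TrivSqZeroExt.fstHom ℚ ℚ M)
    (fun _ hx => isNilpotent_of_map_eq_zero_of_forall_exists_isNilpotent_sub
      trivSqZeroExt_exists_isNilpotent_sub _ hx) hΛ h1 hΛΛ hL hO hinv

/-- **LEMMA 10.1-type statement for `A = ℚ1 ⊕ M`, `M·M = 0`: `W(𝓛(A)) = 𝓔(A)`** — for full lattices `L_1, L_2`:
`L_2 = uL_1` for a unit `u` iff `1 ∈ (L_1:L_2)(L_2:L_1)`. [cite: HertlingLarabi2026b, §10 Lemma 10.1 (proof: `F = ℚ·1_A`) and §12, chunks p0033, p0041] -/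
theorem trivSqZeroExt_exists_units_smul_eq_iff_one_mem_div_mul_div
    {L₁ L₂ : Submodule ℤ (TrivSqZeroExt ℚ M)} (hL₁ : IsFullLattice (TrivSqZeroExt ℚ M) L₁)
    (hL₂ : IsFullLattice (TrivSqZeroExt ℚ M) L₂) :
    (∃ u : (TrivSqZeroExt ℚ M)ˣ, u • L₁ = L₂) ↔ (1 : TrivSqZeroExt ℚ M) ∈ (L₁ / L₂) * (L₂ / L₁) :=
  exists_units_smul_eq_iff_one_mem_div_mul_div_of_forall_isNilpotent (TrivSqZeroExt.fstHom ℚ ℚ M)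
    (fun _ hx => isNilpotent_of_map_eq_zero_of_forall_exists_isNilpotent_sub
      trivSqZeroExt_exists_isNilpotent_sub _ hx) hL₁ hL₂

end TrivSqZeroExt

/-! ## §5 Remarks 3.2 (iii): `pr_F⁻¹(F^{unit}) = A^{unit}` and `pr_F(A^{unit}) = F^{unit}` -/

section Units

variable {A B : Type} [CommRing A] [CommRing B]

/-- **REMARKS 3.2 (iii): `pr_F⁻¹(F^{unit}) = A^{unit}`** — for a surjective ring homomorphism `π : A → B` whose
kernel consists of nilpotent elements, `x ∈ A` is a unit iff `π(x)` is («`A^{unit} = F^{unit} × R`,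
`pr_F⁻¹(F^{unit}) = A^{unit}`»). [cite: HertlingLarabi2026, §3 Rem. 3.2 (iii), chunk p0007] -/
theorem isUnit_iff_isUnit_map_of_forall_isNilpotent {π : A →+* B} (hπ : Surjective π)
    (hnil : ∀ x, π x = 0 → IsNilpotent x) {x : A} : IsUnit x ↔ IsUnit (π x) :=
  ⟨fun h => h.map π, isUnit_of_isUnit_map_of_forall_isNilpotent hπ hnil⟩

/-- **REMARKS 3.2 (iii): `pr_F(A^{unit}) = F^{unit}`** — for a surjective ring homomorphism `π : A → B` whose
kernel consists of nilpotent elements, every unit of `B` is the image of a unit of `A`.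
[cite: HertlingLarabi2026, §3 Rem. 3.2 (iii), chunk p0007] -/
theorem exists_units_map_eq_of_forall_isNilpotent {π : A →+* B} (hπ : Surjective π)
    (hnil : ∀ x, π x = 0 → IsNilpotent x) (f : Bˣ) : ∃ u : Aˣ, Units.map (π : A →* B) u = f := by
  obtain ⟨a, ha⟩ := hπ f
  have hu : IsUnit a :=
    isUnit_of_isUnit_map_of_forall_isNilpotent hπ hnil (by rw [ha]; exact Units.isUnit f)
  exact ⟨hu.unit, Units.ext (by rw [Units.coe_map, MonoidHom.coe_coe, IsUnit.unit_spec, ha])⟩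

end Units

end Literature.NumberTheory.ComplexMultiplication.FiniteQAlgebraLattice
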